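import Summits.AtomisticToContinuum.BoseEinsteinCondensation.Theses.BECZeroCrossingDilute
import Summits.AtomisticToContinuum.BoseEinsteinCondensation.Theorems.BECStronglyRayleighSectorGroundStatePerron
import Summits.AtomisticToContinuum.BoseEinsteinCondensation.Theorems.BECStronglyRayleighPenaltySelectsSector
import Summits.AtomisticToContinuum.BoseEinsteinCondensation.Theorems.BECStronglyRayleighLatticeCoherenceAssemblyGroundSpace
import Literature.MathematicalPhysics.QuantumLattice.SpinChargeKinematics
import Literature.MathematicalPhysics.QuantumLattice.LiebMattisSectorPF
import Literature.MathematicalPhysics.QuantumLattice.SpinChainsAkltCorrelationProofs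
import HarnessLib

/-!
# Penalty selection and Perron–Frobenius for the penalised easy-plane XXZ ferromagnet
# (stub `stub_penalisedPerron`, line `birth`, crux `NearIsotropicDiluteBEC` = stmt-AtomisticToContinuum-13905,
# route BECZeroCrossingDilute, sub-problem BoseEinsteinCondensation)

For `L ≥ 2`, `N ≤ L³`, `0 ≤ Δ ≤ 1` the penalised hard-core XXZ Hamiltonian on `(ℤ/Lℤ)³`,
`K = H_Δ + 4L³·Q²`, `H_Δ = xxzHamiltonian 1 (torusGraph 3 L) (-1) Δ = -Σ_{xy}(S¹S¹ + S²S² + Δ S³S³)`,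
`Q = S³_tot + (L³/2 - N)·1 = diag(L³ - W(σ) - N)`, has the one-dimensional ground space `ℂφ`, `φ` a
unit entrywise-nonnegative vector with `Qφ = 0`. The XXZ twin of the landed XY theorems
`SectorGroundStatePerron_proof`, `PenaltySelectsSector_proof`, `LatticeCoherence.groundState_penalised`:
(1) Perron–Frobenius in the weight sector `L³ - N` (`stoquastic_sector_perronFrobenius`; entries of
`H_Δ` real symmetric, `-½ ≤ 0` per hop, weight preserving — `leadPF_entries` at zero field);
(2) penalty selection by an ASYMMETRIC form `nidA_penSel_core'` of `penSel_core`: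
`Re⟨φ, H_Δφ⟩ ≥ -¾|E|‖φ‖²` (`¼ ∓ SᵅSᵅ ≥ 0`), a sector diagonal entry `-ΔΣ(½-σ_x)(½-σ_y) ≤ ¼|E|`,
and `|E| ≤ 3L³ < 4L³`; (3) on `ker Q`, `K = H_Δ`, so `E₀(K) = E_min(sector)` variationally and
sector uniqueness gives `ker(K - E₀) = ℂψ`; (4) normalise. Tasaki (2020) §2.4; Lieb–Wu (2003) §2;
Kennedy–Lieb–Shastry (1988). [folklore]
-/

noncomputable section

namespace Summit.AtomisticToContinuum.BoseEinsteinCondensation.Cruxes.NearIsotropicDiluteBEC.Birth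

open scoped BigOperators Matrix ComplexOrder
open Literature.MathematicalPhysics.QuantumLattice Literature.Probability.LatticeModels Matrix Complex Finset
open Summit.AtomisticToContinuum.BoseEinsteinCondensation.Theorems BECStronglyRayleighSectorPerron
  InsertionFieldDelocalisation.Negative EigenvalueContinuation
open Summit.AtomisticToContinuum.BoseEinsteinCondensation.Cruxes.GroundStateStability.StableConeVariationalSelection

/-- **A penalty larger than the spectral width selects the kernel (asymmetric `penSel_core`).**
`H₀` Hermitian with no entries between different level sets of `q`, `Re⟨φ, H₀φ⟩ ≥ -R₁‖φ‖²`, a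
diagonal entry `≤ R₂` at a zero of `q`, `q² ≥ 1` off `{q = 0}`, `0 ≤ c`, `R₁ + R₂ < c`: every ground
vector of `H₀ + c·diag(q)²` is supported in `{q = 0}` (its part off `{q = 0}` is again a ground
vector, of energy `≥ c - R₁` if nonzero, while the basis vector gives `E₀ ≤ R₂`). [folklore] -/
theorem nidA_penSel_core' {ι : Type*} [Fintype ι] [DecidableEq ι] (H₀ : Matrix ι ι ℂ)
    (hH₀ : H₀.IsHermitian) (q : ι → ℝ) (R₁ R₂ c : ℝ) (hblock : ∀ i j, q i ≠ q j → H₀ i j = 0)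
    (hlow : ∀ φ : ι → ℂ, -(R₁ * (star φ ⬝ᵥ φ).re) ≤ (star φ ⬝ᵥ H₀ *ᵥ φ).re)
    (hdiag : ∃ i₀, q i₀ = 0 ∧ (H₀ i₀ i₀).re ≤ R₂) (hq1 : ∀ i, q i ≠ 0 → 1 ≤ q i ^ 2)
    (hc0 : 0 ≤ c) (hc : R₁ + R₂ < c) {ψ : ι → ℂ}
    (hψ : ψ ∈ (H₀ + (c : ℂ) • (diagonal fun i => (q i : ℂ)) ^ 2).groundSpace) :
    (diagonal fun i => (q i : ℂ)) *ᵥ ψ = 0 := by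
  have hpen : ((c : ℂ) • (diagonal fun i => (q i : ℂ)) ^ 2 : Matrix ι ι ℂ) =
      diagonal fun i => ((c * q i ^ 2 : ℝ) : ℂ) := by
    rw [diagonal_pow, ← diagonal_smul]
    congr 1
    funext i
    simp only [Pi.smul_apply, Pi.pow_apply, smul_eq_mul, Complex.ofReal_mul, Complex.ofReal_pow]
  set H : Matrix ι ι ℂ := H₀ + (c : ℂ) • (diagonal fun i => (q i : ℂ)) ^ 2 with hHdef
  have hH' : H = H₀ + diagonal fun i => ((c * q i ^ 2 : ℝ) : ℂ) := by rw [hHdef, hpen]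
  have hHerm : H.IsHermitian := by
    rw [hH']
    refine hH₀.add (Matrix.isHermitian_diagonal_iff.mpr fun i => ?_)
    rw [isSelfAdjoint_iff, Complex.star_def, Complex.conj_ofReal]
  set E₀ : ℝ := H.groundEnergy with hE₀
  have hHψ : H *ᵥ ψ = (E₀ : ℂ) • ψ := (Matrix.mem_groundSpace_iff H ψ).1 hψ
  have hHblock : ∀ i j, q i ≠ q j → H i j = 0 := fun i j hij => by
    rw [hH', Matrix.add_apply, hblock i j hij, diagonal_apply_ne _ (fun h => hij (by rw [h])),
      add_zero]
  have hquad : ∀ φ : ι → ℂ, (star φ ⬝ᵥ H *ᵥ φ).re =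
      (star φ ⬝ᵥ H₀ *ᵥ φ).re + ∑ i, c * q i ^ 2 * ‖φ i‖ ^ 2 := fun φ => by
    rw [hH', penSel_re_quad_add, penSel_re_quad_diagonal]
  -- the unit basis vector at a zero of `q` with small diagonal entry: `E₀ ≤ R₂`
  obtain ⟨i₀, hi₀, hi₀R⟩ := hdiag
  have hup : E₀ ≤ R₂ := by
    set e : ι → ℂ := Pi.single i₀ 1 with he
    have hstar_e : star e = e := by rw [he, ← Pi.single_star, star_one]
    have he1 : star e ⬝ᵥ e = 1 := by rw [hstar_e, he, single_one_dotProduct, Pi.single_eq_same]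
    have h1 : E₀ ≤ (star e ⬝ᵥ H *ᵥ e).re := Matrix.groundEnergy_le_rayleigh_holds hHerm e he1
    have h2 : (star e ⬝ᵥ H *ᵥ e).re = (H₀ i₀ i₀).re := by
      rw [hquad, hstar_e, he, mulVec_single_one, single_one_dotProduct, Matrix.col_apply,
        add_eq_left]
      refine Finset.sum_eq_zero fun i _ => ?_
      by_cases hi : i = i₀
      · rw [hi, hi₀]
        ring
      · rw [Pi.single_eq_of_ne hi, norm_zero]
        ring
    linarith
  -- the part of `ψ` off `ker q` is again an eigenvector for `E₀`, hence zero
  set ψb : ι → ℂ := fun i => if q i = 0 then 0 else ψ i with hψb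
  have hψb_apply : ∀ i, ψb i = if q i = 0 then 0 else ψ i := fun i => rfl
  have hHψb : H *ᵥ ψb = (E₀ : ℂ) • ψb := by
    funext i
    rw [Pi.smul_apply, smul_eq_mul, mulVec, dotProduct, hψb_apply i]
    by_cases hi : q i = 0
    · rw [if_pos hi, mul_zero]
      refine Finset.sum_eq_zero fun j _ => ?_
      rw [hψb_apply j]
      by_cases hj : q j = 0
      · rw [if_pos hj, mul_zero]
      · rw [if_neg hj, hHblock i j (by rw [hi]; exact Ne.symm hj), zero_mul]
    · have h1 := congrFun hHψ i
      rw [Pi.smul_apply, smul_eq_mul, mulVec, dotProduct] at h1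
      rw [if_neg hi, ← h1]
      refine Finset.sum_congr rfl fun j _ => ?_
      rw [hψb_apply j]
      by_cases hj : q j = 0
      · rw [if_pos hj, hHblock i j (by rw [hj]; exact hi), zero_mul, zero_mul]
      · rw [if_neg hj]
  have hψb0 : ψb = 0 := by
    by_contra hne
    have hpos : 0 < (star ψb ⬝ᵥ ψb).re := re_star_dotProduct_self_pos hne
    have hE : (star ψb ⬝ᵥ H *ᵥ ψb).re = E₀ * (star ψb ⬝ᵥ ψb).re :=
      re_star_dotProduct_mulVec_of_eigen hHψb
    have hpenb : c * (star ψb ⬝ᵥ ψb).re ≤ ∑ i, c * q i ^ 2 * ‖ψb i‖ ^ 2 := by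
      rw [re_star_dotProduct_self, Finset.mul_sum]
      refine Finset.sum_le_sum fun i _ => ?_
      by_cases hi : q i = 0
      · rw [show ψb i = 0 by rw [hψb_apply i, if_pos hi], norm_zero]
        ring_nf
        rfl
      · nlinarith [hq1 i hi, mul_nonneg hc0 (sq_nonneg ‖ψb i‖)]
    have hlow' : c - R₁ ≤ E₀ := by
      have h1 := hlow ψb
      have h3 := hE
      rw [hquad] at h3
      have h4 : (c - R₁) * (star ψb ⬝ᵥ ψb).re ≤ E₀ * (star ψb ⬝ᵥ ψb).re := by nlinarith
      exact le_of_mul_le_mul_right h4 hpos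
    linarith
  funext i
  rw [Pi.zero_apply, mulVec_diagonal]
  by_cases hi : q i = 0
  · rw [hi, Complex.ofReal_zero, zero_mul]
  · have h := congrFun hψb0 i
    rw [hψb_apply i, if_neg hi, Pi.zero_apply] at h
    rw [h, mul_zero]

section Lattice

variable {Λ : Type*} [Fintype Λ] [DecidableEq Λ] (G : SimpleGraph Λ) [DecidableRel G.Adj]

/-- **The easy-plane XXZ quadratic form is bounded by `¾|E|`**: for `0 ≤ Δ ≤ 1`,
`|Re⟨φ, H_Δ φ⟩| ≤ ¾|E|‖φ‖²`, `H_Δ = -Σ_{xy∈E}(S¹S¹ + S²S² + Δ S³S³)` (each component `≤ ¼‖φ‖²`).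
[folklore] -/
theorem nidA_re_quad_xxz_abs_le {Δ : ℝ} (hΔ0 : 0 ≤ Δ) (hΔ1 : Δ ≤ 1) (φ : TensorIndex Λ 2 → ℂ) :
    |(star φ ⬝ᵥ (xxzHamiltonian 1 G (-1) Δ) *ᵥ φ).re| ≤
      3 / 4 * (G.edgeFinset.card : ℝ) * (star φ ⬝ᵥ φ).re := by
  have hn : 0 ≤ (star φ ⬝ᵥ φ).re := re_star_dotProduct_self_nonneg φ
  have hbond : ∀ e : Sym2 Λ,
      |(star φ ⬝ᵥ (Sym2.lift ⟨fun x y => spinBond 1 0 x y + spinBond 1 1 x y +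
          ((Δ : ℝ) : ℂ) • spinBond 1 2 x y, fun x y => by simp only [spinBond_comm]⟩ e :
            Op Λ 2) *ᵥ φ).re| ≤ 3 / 4 * (star φ ⬝ᵥ φ).re := by
    intro e
    induction e using Sym2.ind with
    | h x y =>
      simp only [Sym2.lift_mk]
      have h0 := abs_le.1 (penSel_re_quad_spinBond_abs_le x y 0 φ)
      have h1 := abs_le.1 (penSel_re_quad_spinBond_abs_le x y 1 φ)
      have h2 := abs_le.1 (penSel_re_quad_spinBond_abs_le x y 2 φ)
      have hlo : -(1 / 4 * (star φ ⬝ᵥ φ).re) ≤ Δ * (star φ ⬝ᵥ (spinBond 1 2 x y) *ᵥ φ).re := by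
        nlinarith [mul_nonneg hΔ0 (neg_le_iff_add_nonneg.1 h2.1), mul_nonneg (sub_nonneg.2 hΔ1) hn]
      have hhi : Δ * (star φ ⬝ᵥ (spinBond 1 2 x y) *ᵥ φ).re ≤ 1 / 4 * (star φ ⬝ᵥ φ).re := by
        nlinarith [mul_nonneg hΔ0 (sub_nonneg.2 h2.2), mul_nonneg (sub_nonneg.2 hΔ1) hn]
      rw [penSel_re_quad_add, penSel_re_quad_add, penSel_re_quad_real_smul, abs_le]
      constructor <;> linarith [h0.1, h0.2, h1.1, h1.2]
  unfold xxzHamiltonian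
  rw [penSel_re_quad_real_smul, penSel_re_quad_sum, neg_one_mul, abs_neg]
  refine (Finset.abs_sum_le_sum_abs _ _).trans
    ((Finset.sum_le_sum fun e _ => hbond e).trans (le_of_eq ?_))
  rw [Finset.sum_const, nsmul_eq_mul]
  ring

/-- **Diagonal entries of the Heisenberg exchange** (`J = 1`, spin `½`):
`⟨σ|Σ_{xy∈E} 𝐒_x·𝐒_y|σ⟩ = Σ_{xy∈E}(½ - σ_x)(½ - σ_y)`. Tasaki (2020) eq. (2.4.3). [folklore] -/
theorem nidA_heisenberg_apply_self (σ : TensorIndex Λ 2) :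
    (heisenbergHamiltonian 1 G 1 : Op Λ 2) σ σ =
      ((∑ e ∈ G.edgeFinset, Sym2.lift ⟨fun x y => ((1 : ℝ) / 2 - (σ x : ℕ)) * ((1 : ℝ) / 2 - (σ y : ℕ)),
        fun _ _ => mul_comm _ _⟩ e : ℝ) : ℂ) := by
  rw [LiebMattis.heisenbergHamiltonian_apply, Complex.ofReal_one, one_mul, Complex.ofReal_sum]
  refine Finset.sum_congr rfl fun e he => ?_
  revert he
  induction e using Sym2.ind with
  | h x y =>
    intro he
    rw [SimpleGraph.mem_edgeFinset, SimpleGraph.mem_edgeSet] at he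
    simp only [spinDotSym_mk, Sym2.lift_mk]
    rw [LiebMattis.spinDot_apply_self 1 he.ne]
    push_cast
    ring

/-- **Diagonal entries of the easy-plane XXZ Hamiltonian are at most `¼|E|`** (`0 ≤ Δ ≤ 1`):
`⟨σ|H_Δ|σ⟩ = -Δ Σ_{xy∈E}(½ - σ_x)(½ - σ_y)` (`H_Δ = -H_Heis + (1-Δ)Σ SᶻSᶻ`, `leadPF_ham_eq`),
each summand of modulus `¼`. [folklore] -/
theorem nidA_xxz_apply_self_re_le {Δ : ℝ} (hΔ0 : 0 ≤ Δ) (hΔ1 : Δ ≤ 1) (σ : TensorIndex Λ 2) :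
    ((xxzHamiltonian 1 G (-1) Δ : Op Λ 2) σ σ).re ≤ (G.edgeFinset.card : ℝ) / 4 := by
  have hb : ∀ e ∈ G.edgeFinset, |Sym2.lift ⟨fun x y => ((1 : ℝ) / 2 - (σ x : ℕ)) *
      ((1 : ℝ) / 2 - (σ y : ℕ)), fun _ _ => mul_comm _ _⟩ e| ≤ 1 / 4 := by
    intro e _
    induction e using Sym2.ind with
    | h x y =>
      simp only [Sym2.lift_mk]
      have hs : ∀ z : Λ, |(1 : ℝ) / 2 - (σ z : ℕ)| ≤ 1 / 2 := by
        intro z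
        have h1 : ((σ z : ℕ) : ℝ) ≤ 1 := by exact_mod_cast Nat.lt_succ_iff.1 (σ z).isLt
        have h0 : (0 : ℝ) ≤ ((σ z : ℕ) : ℝ) := Nat.cast_nonneg _
        rw [abs_le]
        constructor <;> linarith
      rw [abs_mul]
      calc |(1 : ℝ) / 2 - (σ x : ℕ)| * |(1 : ℝ) / 2 - (σ y : ℕ)|
          ≤ 1 / 2 * (1 / 2) := mul_le_mul (hs x) (hs y) (abs_nonneg _) (by norm_num)
        _ = 1 / 4 := by norm_num
  have hS : |∑ e ∈ G.edgeFinset, Sym2.lift ⟨fun x y => ((1 : ℝ) / 2 - (σ x : ℕ)) *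
      ((1 : ℝ) / 2 - (σ y : ℕ)), fun _ _ => mul_comm _ _⟩ e| ≤ (G.edgeFinset.card : ℝ) / 4 := by
    refine (Finset.abs_sum_le_sum_abs _ _).trans ((Finset.sum_le_sum hb).trans (le_of_eq ?_))
    rw [Finset.sum_const, nsmul_eq_mul]
    ring
  have hd := leadPF_ham_eq G Δ (fun _ => (0 : ℝ))
  simp only [Complex.ofReal_zero, zero_smul, Finset.sum_const_zero, add_zero, zero_mul] at hd
  rw [hd, Matrix.add_apply, Matrix.neg_apply, diagonal_apply_eq, nidA_heisenberg_apply_self,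
    ← Complex.ofReal_neg, ← Complex.ofReal_add, Complex.ofReal_re]
  have hS' := abs_le.1 hS
  have hcard : (0 : ℝ) ≤ (G.edgeFinset.card : ℝ) / 4 := by positivity
  nlinarith [mul_nonneg hΔ0 (neg_le_iff_add_nonneg.1 hS'.1), mul_nonneg (sub_nonneg.2 hΔ1) hcard]

end Lattice

/-- **Penalty selects the sector for the easy-plane XXZ ferromagnet on `(ℤ/Lℤ)^d`.** For
`N ≤ L^d`, `0 ≤ Δ ≤ 1`, ground vectors of `H_Δ + (d+1)L^d·(S³_tot + (L^d/2 - N))²` are annihilated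
by `S³_tot + (L^d/2 - N) = diag(L^d - W(σ) - N)` (integer diagonal; `H_Δ` preserves the weight,
`Re⟨φ, H_Δφ⟩ ≥ -¾|E|‖φ‖²`, a sector diagonal entry is `≤ ¼|E|`, `|E| ≤ dL^d < (d+1)L^d`;
`nidA_penSel_core'`). [folklore] -/
theorem nidA_penSel_xxz (d L : ℕ) [NeZero L] (N : ℕ) (hN : N ≤ L ^ d) {Δ : ℝ} (hΔ0 : 0 ≤ Δ)
    (hΔ1 : Δ ≤ 1) (ψ : TensorIndex (TorusSite d L) 2 → ℂ)
    (hψ : ψ ∈ (xxzHamiltonian 1 (torusGraph d L) (-1) Δ + (((d + 1) * L ^ d : ℕ) : ℂ) •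
      (totalSpin 1 2 + ((L : ℂ) ^ d / 2 - (N : ℂ)) • 1) ^ 2).groundSpace) :
    (totalSpin (Λ := TorusSite d L) 1 2 + ((L : ℂ) ^ d / 2 - (N : ℂ)) • 1) *ᵥ ψ = 0 := by
  have hcard : Fintype.card (TorusSite d L) = L ^ d := card_torusSite d L
  -- `Q = S³_tot + (L^d/2 - N)·1` is the real diagonal `diag(L^d - W(σ) - N)`
  have hQ : (totalSpin (Λ := TorusSite d L) 1 2 + ((L : ℂ) ^ d / 2 - (N : ℂ)) • 1 :
      Op (TorusSite d L) 2) =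
      diagonal fun σ => (((L : ℝ) ^ d - ((∑ x, (σ x : ℕ) : ℕ) : ℝ) - N : ℝ) : ℂ) := by
    rw [LiebMattis.totalSpin_two_eq_diagonal, smul_one_eq_diagonal, diagonal_add]
    congr 1
    funext σ
    rw [LiebMattis.magnetisation_eq_sub_weight, hcard]
    push_cast
    ring
  have hc : ((((d + 1) * L ^ d : ℕ) : ℂ)) = (((((d + 1) * L ^ d : ℕ) : ℝ)) : ℂ) := by norm_cast
  rw [hQ, hc] at hψ
  rw [hQ]
  refine nidA_penSel_core' (xxzHamiltonian 1 (torusGraph d L) (-1) Δ)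
    (xxzHamiltonian_isHermitian 1 _ (-1) Δ) _ (3 / 4 * ((torusGraph d L).edgeFinset.card : ℝ))
    (((torusGraph d L).edgeFinset.card : ℝ) / 4) _ ?_
    (fun φ => (abs_le.1 (nidA_re_quad_xxz_abs_le (torusGraph d L) hΔ0 hΔ1 φ)).1) ?_ ?_
    (by positivity) ?_ hψ
  · -- the XXZ Hamiltonian preserves the weight
    intro σ τ hστ
    refine LiebMattis.apply_eq_zero_of_commute_totalSpin_two 1
      (penSel_commute_xxz_totalSpin_two (torusGraph d L) Δ) (fun hW => hστ ?_)
    simp only [hW]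
  · -- a configuration in the sector (nonempty as `N ≤ L^d`), with small diagonal entry
    obtain ⟨σ, hσ⟩ := exists_config_weight_eq d L (L ^ d - N) (Nat.sub_le _ _)
    refine ⟨σ, ?_, nidA_xxz_apply_self_re_le (torusGraph d L) hΔ0 hΔ1 σ⟩
    simp only [hσ]
    push_cast [Nat.cast_sub hN]
    ring
  · -- integrality: `(L^d - W - N)² ≥ 1` unless it vanishes
    intro σ hσ
    have hk : ((L : ℝ) ^ d - ((∑ x, (σ x : ℕ) : ℕ) : ℝ) - N : ℝ) =
        (((L ^ d : ℕ) : ℤ) - ((∑ x, (σ x : ℕ) : ℕ) : ℤ) - (N : ℤ) : ℤ) := by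
      push_cast
      ring
    rw [hk] at hσ ⊢
    have hk0 : (((L ^ d : ℕ) : ℤ) - ((∑ x, (σ x : ℕ) : ℕ) : ℤ) - (N : ℤ) : ℤ) ≠ 0 := by
      exact_mod_cast hσ
    exact_mod_cast (one_le_sq_iff_one_le_abs _).mpr (Int.one_le_abs hk0)
  · -- the penalty exceeds the width: `¾|E| + ¼|E| = |E| ≤ d L^d < (d+1) L^d`
    have hE : ((torusGraph d L).edgeFinset.card : ℝ) ≤ (d : ℝ) * (L : ℝ) ^ d := by
      exact_mod_cast penSel_card_edgeFinset_torusGraph_le d L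
    have hL : (0 : ℝ) < (L : ℝ) ^ d := pow_pos (by exact_mod_cast Nat.pos_of_ne_zero (NeZero.ne L)) d
    push_cast
    nlinarith

/-- **Stub A (`stub_penalisedPerron`): penalty selection + Perron–Frobenius for the penalised
easy-plane XXZ ferromagnet on `(ℤ/Lℤ)³`.** For `L ≥ 2`, `N ≤ L³`, `0 ≤ Δ ≤ 1` the ground space of
`K = H_Δ + 4L³·(S³_tot + (L³/2 - N))²` is the complex line through one unit, entrywise nonnegative
vector `φ` annihilated by `S³_tot + (L³/2 - N)`: the Perron vector `ψ` of the weight sector `L³ - N`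
of `H_Δ` (`stoquastic_sector_perronFrobenius`: real symmetric entries, `-½ ≤ 0` per hop, weight
preserving, connected torus) spans the ground space of `K`, because ground vectors of `K` lie in the
sector (`nidA_penSel_xxz`), where `K = H_Δ` and `E₀(K) = E_min(sector)` by the variational principle
(`sector_groundState`); normalise `ψ`. Tasaki (2020) §2.4; Lieb–Wu (2003) §2. [folklore] -/
theorem stub_penalisedPerron :
    ∀ (L : ℕ) [NeZero L], 2 ≤ L → ∀ N : ℕ, N ≤ L ^ 3 → ∀ Δ : ℝ, 0 ≤ Δ → Δ ≤ 1 → ∃ φ : TensorIndex (TorusSite 3 L) 2 → ℂ, (∀ σ, φ σ = ((‖φ σ‖ : ℝ) : ℂ)) ∧ star φ ⬝ᵥ φ = 1 ∧ ((totalSpin 1 2 : Op (TorusSite 3 L) 2) + ((L : ℂ) ^ 3 / 2 - (N : ℂ)) • 1) *ᵥ φ = 0 ∧ φ ∈ (xxzHamiltonian 1 (torusGraph 3 L) (-1) Δ + (((3 + 1) * L ^ 3 : ℕ) : ℂ) • (totalSpin 1 2 + ((L : ℂ) ^ 3 / 2 - (N : ℂ)) • 1) ^ 2).groundSpace ∧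 ∀ ψ : TensorIndex (TorusSite 3 L) 2 → ℂ, ψ ∈ (xxzHamiltonian 1 (torusGraph 3 L) (-1) Δ + (((3 + 1) * L ^ 3 : ℕ) : ℂ) • (totalSpin 1 2 + ((L : ℂ) ^ 3 / 2 - (N : ℂ)) • 1) ^ 2).groundSpace → ∃ c : ℂ, ψ = c • φ := by
  intro L _ _ N hN Δ hΔ0 hΔ1
  -- (1) Perron–Frobenius in the weight sector `L³ - N` of `H_Δ`
  have hent := leadPF_entries (torusGraph 3 L) Δ (fun _ => (0 : ℝ))
  simp only [Complex.ofReal_zero, zero_smul, Finset.sum_const_zero, add_zero] at hent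
  obtain ⟨happ, hreal, hsymm, hoff, hwt⟩ := hent
  have hW : ∃ σ : TensorIndex (TorusSite 3 L) 2, (∑ z, (σ z : ℕ)) = L ^ 3 - N :=
    exists_config_weight_eq 3 L (L ^ 3 - N) (Nat.sub_le _ _)
  obtain ⟨⟨ψ, hψK, hψ0, hψnn, hHψ⟩, huniq⟩ :=
    stoquastic_sector_perronFrobenius 1 (torusGraph 3 L) (torusGraph_connected 3 L)
      (xxzHamiltonian 1 (torusGraph 3 L) (-1) Δ)
      (fun σ τ hστ h h0 => h (neg_eq_zero.1 ((happ σ τ hστ).symm.trans h0)))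
      hreal hsymm hoff hwt (L ^ 3 - N) hW
  have hM : ((Fintype.card (TorusSite 3 L) * 1 : ℕ) : ℝ) / 2 - ((L ^ 3 - N : ℕ) : ℝ) =
      (N : ℝ) - (L : ℝ) ^ 3 / 2 := by
    rw [card_torusSite, Nat.cast_sub hN]
    push_cast
    ring
  rw [hM] at hψK hHψ huniq
  set H : Op (TorusSite 3 L) 2 := xxzHamiltonian 1 (torusGraph 3 L) (-1) Δ with hHdef
  set Pen : Op (TorusSite 3 L) 2 := totalSpin 1 2 + ((L : ℂ) ^ 3 / 2 - (N : ℂ)) • 1 with hPendef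
  set k : ℂ := (((3 + 1) * L ^ 3 : ℕ) : ℂ) with hkdef
  set Hp : Op (TorusSite 3 L) 2 := H + k • Pen ^ 2 with hHpdef
  set E : ℝ := lowestEnergyInSector 1 H ((N : ℝ) - (L : ℝ) ^ 3 / 2) with hEdef
  have hHpherm : Hp.IsHermitian := by
    have hsa : IsSelfAdjoint ((L : ℂ) ^ 3 / 2 - (N : ℂ)) := by
      rw [isSelfAdjoint_iff, show ((L : ℂ) ^ 3 / 2 - (N : ℂ)) = (((L : ℝ) ^ 3 / 2 - (N : ℝ) : ℝ) : ℂ)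
        by push_cast; ring, Complex.star_def, Complex.conj_ofReal]
    have hk : IsSelfAdjoint k := by rw [isSelfAdjoint_iff, hkdef, Complex.star_def, map_natCast]
    exact (xxzHamiltonian_isHermitian 1 _ (-1) Δ).add
      ((((totalSpin_isHermitian 1 2).add (isHermitian_one.smul hsa)).pow 2).smul hk)
  -- on the kernel of the penalty the penalised Hamiltonian is `H`
  have hHp_of_pen : ∀ φ : TensorIndex (TorusSite 3 L) 2 → ℂ, Pen *ᵥ φ = 0 → Hp *ᵥ φ = H *ᵥ φ := by
    intro φ hφ
    rw [hHpdef, add_mulVec, smul_mulVec, pow_two, ← mulVec_mulVec, hφ, mulVec_zero, smul_zero,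
      add_zero]
  -- (2) penalty selection: ground vectors of `Hp` lie in the sector
  have hsec : ∀ φ : TensorIndex (TorusSite 3 L) 2 → ℂ, φ ∈ Hp.groundSpace →
      Pen *ᵥ φ = 0 ∧ φ ∈ spinZSector 1 ((N : ℝ) - (L : ℝ) ^ 3 / 2) := fun φ hφ =>
    ⟨nidA_penSel_xxz 3 L N hN hΔ0 hΔ1 φ hφ, (LatticeCoherence.penalty_mulVec_eq_zero_iff 3 L N φ).1
      (nidA_penSel_xxz 3 L N hN hΔ0 hΔ1 φ hφ)⟩
  -- (3) glue: `E₀(Hp) = E` and `groundSpace Hp = ℂ ψ`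
  have hPenψ : Pen *ᵥ ψ = 0 := (LatticeCoherence.penalty_mulVec_eq_zero_iff 3 L N ψ).2 hψK
  have hHpψ : Hp *ᵥ ψ = (E : ℂ) • ψ := by rw [hHp_of_pen ψ hPenψ, hHψ]
  have hle1 : Hp.groundEnergy ≤ E := by
    obtain ⟨c, -, hc1⟩ := exists_smul_unit hψ0
    have h := Matrix.groundEnergy_le_rayleigh_holds hHpherm _ hc1
    rwa [mulVec_smul, hHpψ, smul_comm, dotProduct_smul, hc1, smul_eq_mul, mul_one,
      Complex.ofReal_re] at h
  obtain ⟨φ₀, hφ₀mem, hφ₀0⟩ :=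
    (Submodule.ne_bot_iff _).1 (Matrix.groundSpace_ne_bot_holds hHpherm)
  obtain ⟨hPenφ₀, hφ₀sec⟩ := hsec φ₀ hφ₀mem
  have hHφ₀ : H *ᵥ φ₀ = (Hp.groundEnergy : ℂ) • φ₀ := by
    rw [← hHp_of_pen φ₀ hPenφ₀, (Matrix.mem_groundSpace_iff Hp φ₀).1 hφ₀mem]
  have hle2 : E ≤ Hp.groundEnergy := by
    -- the sector energy bounds the Rayleigh quotient of unit sector vectors (`sector_groundState`)
    obtain ⟨-, h2⟩ := sector_groundState H (xxzHamiltonian_isHermitian 1 _ (-1) Δ)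
      (fun σ => (∑ z, (σ z : ℕ)) = L ^ 3 - N) hW (fun σ τ hσ hτ => hwt σ τ (by rw [hτ]; exact hσ))
      (spinZSector 1 ((N : ℝ) - (L : ℝ) ^ 3 / 2)) (LatticeCoherence.mem_sector_iff_weight 3 L N hN)
    obtain ⟨c, -, hc1⟩ := exists_smul_unit hφ₀0
    have h := h2 (c • φ₀) (Submodule.smul_mem _ c hφ₀sec) hc1
    rwa [mulVec_smul, hHφ₀, smul_comm, dotProduct_smul, hc1, smul_eq_mul, mul_one,
      Complex.ofReal_re] at h
  have hE : Hp.groundEnergy = E := le_antisymm hle1 hle2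
  have hψmem : ψ ∈ Hp.groundSpace := by rw [Matrix.mem_groundSpace_iff, hHpψ, hE]
  have hline : ∀ φ : TensorIndex (TorusSite 3 L) 2 → ℂ, φ ∈ Hp.groundSpace → ∃ c : ℂ, φ = c • ψ := by
    intro φ hφ
    obtain ⟨hPenφ, hφsec⟩ := hsec φ hφ
    have hHφ : H *ᵥ φ = (E : ℂ) • φ := by
      rw [← hHp_of_pen φ hPenφ, (Matrix.mem_groundSpace_iff Hp φ).1 hφ, hE]
    exact huniq ψ φ hψK hφsec hHψ hHφ hψ0
  -- (4) normalise the Perron vector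
  obtain ⟨c, hc0, hc1⟩ := exists_smul_unit hψ0
  have hcne : ((‖c‖ : ℝ) : ℂ) ≠ 0 := Complex.ofReal_ne_zero.2 (norm_ne_zero_iff.2 hc0)
  refine ⟨((‖c‖ : ℝ) : ℂ) • ψ, fun σ => ?_, ?_, by rw [mulVec_smul, hPenψ, smul_zero],
    Hp.groundSpace.smul_mem _ hψmem, fun ψ' hψ' => ?_⟩
  · -- entrywise nonnegative
    obtain ⟨hre, him⟩ := hψnn σ
    have hψσ : ψ σ = (((ψ σ).re : ℝ) : ℂ) :=
      Complex.ext (by rw [Complex.ofReal_re]) (by rw [Complex.ofReal_im, him])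
    rw [Pi.smul_apply, smul_eq_mul, hψσ, ← Complex.ofReal_mul, Complex.norm_real,
      Real.norm_of_nonneg (mul_nonneg (norm_nonneg c) hre)]
  · -- unit norm
    rw [star_smul, smul_dotProduct, dotProduct_smul, smul_smul, Complex.star_def, Complex.conj_mul']
      at hc1
    rw [star_smul, smul_dotProduct, dotProduct_smul, smul_smul, Complex.star_def, Complex.conj_ofReal,
      ← pow_two, hc1]
  · -- uniqueness
    obtain ⟨a, ha⟩ := hline ψ' hψ'
    exact ⟨a * ((‖c‖ : ℝ) : ℂ)⁻¹, by rw [ha, smul_smul, mul_assoc, inv_mul_cancel₀ hcne, mul_one]⟩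

end Summit.AtomisticToContinuum.BoseEinsteinCondensation.Cruxes.NearIsotropicDiluteBEC.Birth

end
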